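import Mathlib
import HarnessLib
import HarnessLib.Audit
import Summits.RiemannHypothesis.Statement
import Summits.RiemannHypothesis.RiemannHypothesis.Theses.RuelleBand
import Literature.NumberTheory.LFunctions.BombieriWeilTruncations
import Literature.NumberTheory.LFunctions.WeilArchimedeanPositivityHolds
import Literature.NumberTheory.LFunctions.ZetaZerosProofs
import Literature.NumberTheory.LFunctions.ZeroDensityInghamHuxley
import Literature.NumberTheory.LFunctions.ZeroCounting
import Literature.NumberTheory.LFunctions.GeneralizedRH
import Summits.RiemannHypothesis.RiemannHypothesis.Theorems.WeilFormatCDataA1RungCB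

/-!
# Splitting of record (cell rh-split, cross-family row X-1): Bombieri's trichotomy read as `FOZ ∧ NoDep ⟹ RH`

Class-(a) entry of record — KNOWN in print (E. Bombieri, *Remarks on Weil's quadratic functional in the theory of
prime numbers I*, Rend. Lincei (9) 11 (2000), §11, Corollary to Thm. 11, p. 37), UNDECIDED in substance, and
CONDITIONAL on a named Literature fact used as hypothesis (sanctioned pattern, not a `sorry`):
`Literature.NumberTheory.LFunctions.Bombieri2000.corollary11` (undischarged). Card: HOME/cards/SPLIT-x-barrier.md §4
(seat rh-split-x-barrier g0; scratch `SplitXBarrier.lean`); typed for the tree by rh-split-typer-2.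

* A := FOZ, «only finitely many non-trivial zeros off the critical line» — DEDUPED against the tree: it is the
  existing route decl `Summit.RiemannHypothesis.RiemannHypothesis.Theses.RuelleBand.CofiniteCriticalLine`
  (`{s | ζ s = 0 ∧ 0 < Re s < 1 ∧ Re s ≠ 1/2}.Finite`), which `cofiniteCriticalLine_iff_foz` identifies with
  Bombieri's set over `riemannZetaNontrivialZeros`. RH-IMPLIED; «FOZ ⟹ RH» open (Bombieri's standing hypothesis).
* B := `NoDep a`, the negation of Bombieri's alternative (iii) on the window `[e^{−a}, e^{a}]` (no non-zero `ℓ²`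
  relation among the `x^{−ρ}`, at least half of whose mass sits on off-line zeros) — new `@[conjecture]` def
  (no tree decl states (iii) by itself; the fact `corollary11` inlines it). RH-IMPLIED (vacuously: no off-line zeros).
* `rh_of_foz_noDep`: for any PROVED positivity rung `WeilPositivityOn a` (`a > 0`; tree: Yoshida's `(log 2)/2`,
  `weilPositivityOn_log_two_half_holds`), `corollary11 → FOZ → NoDep a → RiemannHypothesis`.
Referee reading (x-barrier card): tautology PASS-shaped (B is not RH / E_F / A → RH by one line; A consumed:
Thm 11 uses the finiteness essentially), both conjuncts RH-implied ⇒ cheap refutation UNDECIDED by construction.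
HONEST LABEL: SPLITTING SEARCH over kernel-typed RH-EQUIVALENCES; a splitting A ∧ B ⟹ RH is CONDITIONAL
bookkeeping unless A and B are both proved; nothing here bears on the truth of RH.
-/

set_option linter.dupNamespace false  -- the mandated namespace repeats `RiemannHypothesis`

noncomputable section

namespace Summit.RiemannHypothesis.RiemannHypothesis.Theorems.Splittings.BombieriFozNoDep

open Set Literature.NumberTheory.LFunctions Literature.NumberTheory.LFunctions.Bombieri2000
open Summit.RiemannHypothesis.RiemannHypothesis.Theses.RuelleBand

/-- Bombieri's alternative (ii) negated, over the tree's set of non-trivial zeros, is the RuelleBand crux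
`CofiniteCriticalLine` (the two index sets coincide by `mem_riemannZetaNontrivialZeros_iff_holds`).
[cite: Bombieri2000Weil, Thm. 11 and Corollary (p. 36–37)] -/
theorem cofiniteCriticalLine_iff_foz :
    CofiniteCriticalLine ↔ {ρ : ℂ | ρ ∈ ZetaZeros.riemannZetaNontrivialZeros ∧ ρ.re ≠ 1 / 2}.Finite := by
  have hset : {s : ℂ | riemannZeta s = 0 ∧ 0 < s.re ∧ s.re < 1 ∧ s.re ≠ 1 / 2} =
      {ρ : ℂ | ρ ∈ ZetaZeros.riemannZetaNontrivialZeros ∧ ρ.re ≠ 1 / 2} := by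
    ext ρ
    simp only [mem_setOf_eq]
    rw [mem_riemannZetaNontrivialZeros_iff_holds]
    tauto
  unfold CofiniteCriticalLine
  rw [hset]

/-- **B = `NoDep a`** — negation of Bombieri's alternative (iii) on the window `𝓔 = [e^{−a}, e^{a}]`: there is NO
non-zero square-summable `c` on the zero indices, with `∑ ‖c‖² ≤ 2 ∑_{off-line} ‖c‖²`, making the `x^{−ρ}` linearly
dependent over `𝓔` (`XPowLinDepOn`). Open; RH-implied vacuously (`noDep_of_rh`). Bombieri p. 4: «the question of
linear independence which arises in (iii) … although probably quite difficult, deserves study».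
[cite: Bombieri2000Weil, §1 p. 4 and Corollary to Thm. 11 p. 37] -/
@[conjecture] def NoDep (a : ℝ) : Prop :=
  ¬ ∃ c : ZeroIdx → ℂ, c ≠ 0 ∧ Summable (fun i ↦ ‖c i‖ ^ 2) ∧
      (∑' i, ‖c i‖ ^ 2) ≤ 2 * ∑' i : {i : ZeroIdx // i.OffLine}, ‖c i‖ ^ 2 ∧
      XPowLinDepOn (Icc (Real.exp (-a)) (Real.exp a)) c

/-- **The splitting, CONDITIONAL on the named fact `corollary11`**: a proved positivity rung `WeilPositivityOn a`
(`0 < a`) together with `CofiniteCriticalLine` (FOZ) and `NoDep a` gives RH — Bombieri's trichotomy with the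
alternatives (ii), (iii) excluded by hypothesis. [cite: Bombieri2000Weil, Corollary to Thm. 11 (p. 37)] -/
theorem rh_of_foz_noDep (h11 : corollary11) {a : ℝ} (ha : 0 < a) (hW : WeilPositivityOn a)
    (hfoz : CofiniteCriticalLine) (hdep : NoDep a) : _root_.RiemannHypothesis := by
  rcases h11.of_weilPositivityOn ha hW with h | h | h
  · exact h
  · exact absurd (cofiniteCriticalLine_iff_foz.1 hfoz) h
  · exact absurd h hdep

/-- The instance on Yoshida's PROVED rung `a = (log 2)/2` (`weilPositivityOn_log_two_half_holds`): given the named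
fact `corollary11`, `CofiniteCriticalLine → NoDep ((log 2)/2) → RH`. [cite: Bombieri2000Weil, Corollary to Thm. 11 (p. 37)] -/
theorem rh_of_foz_noDep_yoshida (h11 : corollary11) (hfoz : CofiniteCriticalLine)
    (hdep : NoDep (Real.log 2 / 2)) : _root_.RiemannHypothesis :=
  rh_of_foz_noDep h11 (div_pos (Real.log_pos (by norm_num)) two_pos)
    weilPositivityOn_log_two_half_holds hfoz hdep

/-- Under RH every non-trivial zero has real part `1/2`. [folklore] -/
theorem re_eq_half_of_rh (hRH : _root_.RiemannHypothesis) {ρ : ℂ}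
    (hρ : ρ ∈ ZetaZeros.riemannZetaNontrivialZeros) : ρ.re = 1 / 2 := by
  have h := mem_riemannZetaNontrivialZeros_iff_holds.1 hρ
  refine hRH ρ h.1 ?_ ?_
  · rintro ⟨n, hn⟩
    have h2 : (0 : ℝ) < (-2 * ((n : ℂ) + 1)).re := by rw [← hn]; exact h.2.1
    have hn0 : (0 : ℝ) ≤ (n : ℝ) := Nat.cast_nonneg n
    simp at h2
    linarith
  · rintro rfl
    have h3 := h.2.2
    simp at h3

/-- RH ⟹ `CofiniteCriticalLine` (under RH the off-line set is empty). [folklore] -/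
theorem cofiniteCriticalLine_of_rh (hRH : _root_.RiemannHypothesis) : CofiniteCriticalLine := by
  rw [cofiniteCriticalLine_iff_foz]
  have hempty : {ρ : ℂ | ρ ∈ ZetaZeros.riemannZetaNontrivialZeros ∧ ρ.re ≠ 1 / 2} = ∅ := by
    ext ρ
    simp only [mem_setOf_eq, mem_empty_iff_false, iff_false, not_and, not_not]
    exact fun hρ ↦ re_eq_half_of_rh hRH hρ
  rw [hempty]
  exact finite_empty

/-- RH ⟹ `NoDep a` for every `a`, VACUOUSLY: under RH no index is off-line, so the mass condition forces `c = 0`.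
[cite: Bombieri2000Weil, Corollary to Thm. 11 (p. 37)] -/
theorem noDep_of_rh (hRH : _root_.RiemannHypothesis) (a : ℝ) : NoDep a := by
  rintro ⟨c, hc0, hsum, hmass, -⟩
  have hE : IsEmpty {i : ZeroIdx // i.OffLine} :=
    ⟨fun i ↦ i.2 (re_eq_half_of_rh hRH i.1.val_mem)⟩
  have hzero : (∑' i : {i : ZeroIdx // i.OffLine}, ‖c i‖ ^ 2) = 0 := tsum_empty
  rw [hzero, mul_zero] at hmass
  have hnn : ∀ i, 0 ≤ ‖c i‖ ^ 2 := fun i ↦ by positivity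
  have hle : (∑' i, ‖c i‖ ^ 2) = 0 := le_antisymm hmass (tsum_nonneg hnn)
  have hfun : (fun i ↦ ‖c i‖ ^ 2) = 0 := by
    have hs := hsum.hasSum
    rw [hle] at hs
    exact (hasSum_zero_iff_of_nonneg hnn).1 hs
  apply hc0
  funext i
  have hi := congrFun hfun i
  simp at hi
  simpa using hi

/-- So both conjuncts are RH-IMPLIED and the splitting is an EQUIVALENCE modulo `corollary11`:
`RH ↔ CofiniteCriticalLine ∧ NoDep ((log 2)/2)`. [cite: Bombieri2000Weil, Corollary to Thm. 11 (p. 37)] -/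
theorem rh_iff_foz_and_noDep_yoshida (h11 : corollary11) :
    _root_.RiemannHypothesis ↔ CofiniteCriticalLine ∧ NoDep (Real.log 2 / 2) :=
  ⟨fun h ↦ ⟨cofiniteCriticalLine_of_rh h, noDep_of_rh h _⟩, fun h ↦ rh_of_foz_noDep_yoshida h11 h.1 h.2⟩


/-! ## Appendix (typer-2, cell rh-split zd/x-barrier «counts never give emptiness», crux-level form)

What FOZ DOES give in the kernel: the Density Hypothesis. So every density-type statement sits below the
RuelleBand crux `CofiniteCriticalLine`, and «DH ⟹ RH» would contain «FOZ ⟹ RH» (Bombieri's open standing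
hypothesis). -/

/-- FOZ gives a height tail: above the largest height of the finitely many off-line zeros, every zero of `ζ` in the
upper half-plane is on the critical line. [cite: Bombieri2000Weil, Thm. 11 (p. 36: «only finitely many non-trivial zeros … not on the critical line»)] -/
theorem exists_zdTail_of_cofiniteCriticalLine (h : CofiniteCriticalLine) :
    ∃ H : ℝ, ∀ s : ℂ, riemannZeta s = 0 → 0 < s.im → H < s.im → s.re = 1 / 2 := by
  have hfin : {s : ℂ | riemannZeta s = 0 ∧ 0 < s.re ∧ s.re < 1 ∧ s.re ≠ 1 / 2}.Finite := h
  obtain ⟨H, hH⟩ := (hfin.image Complex.im).bddAbove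
  refine ⟨H, fun s hs h0 hHs ↦ ?_⟩
  by_contra hre
  obtain ⟨hre0, hre1⟩ := re_mem_Ioo_of_riemannZeta_eq_zero_of_im_ne_zero hs h0.ne'
  have hle : s.im ≤ H := hH ⟨s, ⟨hs, hre0, hre1, hre⟩, rfl⟩
  linarith

/-- **`CofiniteCriticalLine → DensityHypothesis`** (F1-free, standard axioms): finitely many off-line zeros already
give `N(σ,T) ≪ T^{2(1−σ)+ε}` on `[1/2, 1]` — for `σ > 1/2` the counting box above the exceptional height is empty
off the line, so `N(σ,T) ≤ N(σ,H) = O(1)`; at `σ = 1/2`, `N ≪ T log T` unconditionally. Hence the Density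
Hypothesis (and every weaker zero-density statement) cannot separate RH from RH-with-finitely-many-exceptions.
[cite: IwaniecKowalski2004, §10.5] -/
theorem densityHypothesis_of_cofiniteCriticalLine (h : CofiniteCriticalLine) : DensityHypothesis := by
  obtain ⟨H, hT⟩ := exists_zdTail_of_cofiniteCriticalLine h
  intro ε hε σ hσ hσ1
  rcases hσ.eq_or_lt with rfl | hlt
  · rw [show (2 : ℝ) * (1 - 1 / 2) + ε = 1 + ε by ring]
    exact (isBigO_zetaZeroCountRe_mul_log (by norm_num)).trans (isBigO_mul_log_rpow hε)
  · have hsub : ∀ T : ℝ, zetaZeroBox σ T ⊆ zetaZeroBox σ H := by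
      rintro T ρ ⟨h0, h1, h2, h3, h4⟩
      refine ⟨h0, h1, h2, h3, ?_⟩
      by_contra hHρ
      have := hT ρ h0 h3 (lt_of_not_ge hHρ)
      linarith
    refine Asymptotics.IsBigO.of_bound (zetaZeroCountRe σ H : ℝ) ?_
    filter_upwards [Filter.eventually_ge_atTop (1 : ℝ)] with T hT1
    rw [Real.norm_of_nonneg (Nat.cast_nonneg _), Real.norm_of_nonneg (Real.rpow_nonneg (by linarith) _)]
    have hle : (zetaZeroCountRe σ T : ℝ) ≤ zetaZeroCountRe σ H := by
      exact_mod_cast zetaZeroCountRe_le_of_subset (hsub T)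
    have hpow : (1 : ℝ) ≤ T ^ (2 * (1 - σ) + ε) := Real.one_le_rpow hT1 (by nlinarith)
    calc (zetaZeroCountRe σ T : ℝ) ≤ zetaZeroCountRe σ H := hle
      _ = (zetaZeroCountRe σ H : ℝ) * 1 := by ring
      _ ≤ (zetaZeroCountRe σ H : ℝ) * T ^ (2 * (1 - σ) + ε) :=
          mul_le_mul_of_nonneg_left hpow (Nat.cast_nonneg _)


/-! ## Appendix 2 (typer-2): the rung `a = 1`, and the OVERSAMPLING caveat of cards/SPLIT-x-wuc.md §4.4

(1) weil-finite H2: the positivity hypothesis `WeilPositivityOn a` is a kernel THEOREM up to `a = 1`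
(`WeilFormatCData.A1.weilPositivityOn_one`, standard axioms), so the exhibit has NO open finite conjunct at `a = 1`.
(2) x-wuc §4.4 (a SKETCH in print-standard analysis, NOT kernel): by Littlewood's gap theorem and Duffin–Schaeffer
frames, «finitely many off-line zeros ∧ at least one» plausibly FORCES a half-mass `ℓ²` relation on every bounded
window (`¬ NoDep a`). IF that oversampling lemma holds, the splitting below needs neither Weil positivity nor Bombieri's
theorem — it is «exceptions finite ∧ no exception» in `ℓ²` clothes (RELABELLING), and the vendored `corollary11` is
nearly content-free AS TYPED (audit flag for the Literature file: the printed content is the provenance of the relation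
as a limit of eigenvectors of the truncations `𝒦_E(Γ_N)`, which the typed Corollary does not retain). Recorded here in
kernel form with the lemma as an explicit RAW hypothesis; nothing is claimed about its truth. -/

/-- The exhibit on the PROVED rung `a = 1` (window `[e⁻¹, e]`): `corollary11 → CofiniteCriticalLine → NoDep 1 → RH`.
[cite: Bombieri2000Weil, Corollary to Thm. 11 (p. 37)] -/
theorem rh_of_foz_noDep_one (h11 : corollary11) (hfoz : CofiniteCriticalLine) (hdep : NoDep 1) :
    _root_.RiemannHypothesis :=
  rh_of_foz_noDep h11 one_pos
    Summit.RiemannHypothesis.RiemannHypothesis.Theorems.WeilFormatCData.A1.weilPositivityOn_one hfoz hdep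

/-- `RH ↔ CofiniteCriticalLine ∧ NoDep 1`, modulo the named fact `corollary11` only (no open finite conjunct).
[cite: Bombieri2000Weil, Corollary to Thm. 11 (p. 37)] -/
theorem rh_iff_foz_and_noDep_one (h11 : corollary11) :
    _root_.RiemannHypothesis ↔ CofiniteCriticalLine ∧ NoDep 1 :=
  ⟨fun h ↦ ⟨cofiniteCriticalLine_of_rh h, noDep_of_rh h _⟩, fun h ↦ rh_of_foz_noDep_one h11 h.1 h.2⟩

/-- If RH fails there is an off-line non-trivial zero (strip form of RH). [folklore] -/
theorem exists_offLine_of_not_rh (hRH : ¬ _root_.RiemannHypothesis) :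
    ∃ ρ : ℂ, ρ ∈ ZetaZeros.riemannZetaNontrivialZeros ∧ ρ.re ≠ 1 / 2 := by
  by_contra hnone
  push Not at hnone
  apply hRH
  refine riemannHypothesis_iff_strip_holds.2 fun s hs h0 h1 ↦ ?_
  exact hnone s (mem_riemannZetaNontrivialZeros_iff_holds.2 ⟨hs, h0, h1⟩)

/-- **The OVERSAMPLING collapse (x-wuc §4.4), kernel form with the lemma as a raw hypothesis**: if «finitely many
off-line zeros ∧ at least one off-line zero ⟹ a half-mass relation on the window `[e^{−a}, e^{a}]`» holds, then
`CofiniteCriticalLine ∧ NoDep a ⟹ RH` uses NEITHER Weil positivity NOR Bombieri's Corollary — the pair is the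
finiteness/emptiness partition in costume. Nothing is claimed here about the truth of that lemma. [folklore] -/
theorem rh_of_foz_noDep_of_oversampling {a : ℝ}
    (hL : CofiniteCriticalLine → (∃ ρ : ℂ, ρ ∈ ZetaZeros.riemannZetaNontrivialZeros ∧ ρ.re ≠ 1 / 2) → ¬ NoDep a)
    (hfoz : CofiniteCriticalLine) (hdep : NoDep a) : _root_.RiemannHypothesis := by
  by_contra hRH
  exact hL hfoz (exists_offLine_of_not_rh hRH) hdep

/-- Consequently, IF the oversampling lemma holds on every admissible window, the vendored `corollary11` follows with its
positivity hypothesis UNUSED (x-wuc's audit flag `corollary11_of_oversampling`, re-typed). [folklore] -/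
theorem corollary11_of_oversampling
    (hL : ∀ 𝓔 : Set ℝ, IsFiniteUnionOfPosIntervals 𝓔 →
      {ρ : ℂ | ρ ∈ ZetaZeros.riemannZetaNontrivialZeros ∧ ρ.re ≠ 1 / 2}.Finite →
      (∃ ρ : ℂ, ρ ∈ ZetaZeros.riemannZetaNontrivialZeros ∧ ρ.re ≠ 1 / 2) →
      ∃ c : ZeroIdx → ℂ, c ≠ 0 ∧ Summable (fun i ↦ ‖c i‖ ^ 2) ∧
        (∑' i, ‖c i‖ ^ 2) ≤ 2 * ∑' i : {i : ZeroIdx // i.OffLine}, ‖c i‖ ^ 2 ∧ XPowLinDepOn 𝓔 c) :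
    corollary11 := by
  intro 𝓔 h𝓔 _hpos
  by_cases hRH : _root_.RiemannHypothesis
  · exact Or.inl hRH
  by_cases hfin : {ρ : ℂ | ρ ∈ ZetaZeros.riemannZetaNontrivialZeros ∧ ρ.re ≠ 1 / 2}.Finite
  · exact Or.inr (Or.inr (hL 𝓔 h𝓔 hfin (exists_offLine_of_not_rh hRH)))
  · exact Or.inr (Or.inl hfin)

end Summit.RiemannHypothesis.RiemannHypothesis.Theorems.Splittings.BombieriFozNoDep

end
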